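import Literature.Barriers.CriticalPhenomena.PlaquetteWalkHoleRootCutSigns
import HarnessLib

/-!
# Barrier catalogue (SAWScalingLimit): THE DEAD CUT — a lattice cut from the root edge to the outside of the domain through
dead edges only kills BOTH routes, and the vertex functional vanishes identically

Leaf of `PlaquetteWalkHoleRootCutSigns` (cone: `PlaquetteWalkHoleRootCutLaw` — the existence half of the cut law
`ΩG.exists_exit_on_cornerChain_of_AJ_ne_zero`, the live-exit lemma `ΩG.exit_faces_mem`, the exit certificates
`ΩG.AJ_cornerPt_eq_zero_of_beyond`; `PlaquetteWalkHoleRootOneRouteSigns` — `vertexFunctional_printed_eq_zero_of_both_unwound`).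
Setting: root plaquette `w` rooted at `W`, far cell `farW w`, hole `holeFaceW w`; `ω` ANY class-`B2a` walk at the far cell (under,
over or west entry alike).

The parent's one-live-edge criterion (`ΩG.WE_eq_excursionWinding_of_under_cut`) is a statement about ONE route: its proof needs
the PREFIX to cross the cut before the excursion does, which is where the first side `S` (cuts from the lower corner) or `N`
(upper corner, by the row mirror) enters. The venture lane's completeness scan of the per-cut predictor against a constructive
witness generator (b-step0 gen 30: all defect sets of ≤ 3 cells in the frames `[0,6]×[−1,5]` and `[1,5]×[0,4]`, 28 896 route-cells)
isolated the one family the route-wise criterion misses: a cut with NO live edge at all. Such a cut needs no prefix: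

* §1 ★★★★★ `ΩG.AJ_root_eq_zero_of_deadCut` / `ΩG.WE_eq_excursionWinding_of_deadCut` — a lattice cut `q 0 = (w.1, w.2), …, q K`
  from the lower corner of the root edge to a corner beyond the domain, EVERY edge of which has a face outside `D`, forces
  `AJ = 0` at the root for EVERY class-`B2a` walk at the far cell — no hypothesis on the first side, none on the hole, none
  excluding the hole's `W` side or the root edge from the cut (they are dead edges like any other when the hole is absent): the
  excursion polygon would have to exit a slot through an edge of the cut (`exists_exit_on_cornerChain_of_AJ_ne_zero`), and exit
  edges are live (`exit_faces_mem`). ★★★ `vertexFunctional_printed_eq_zero_of_deadCut` — hence `V(θ) = 0` on `[π/3, 2π/3]` for a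
  face list with the far cell present and the hole absent. In words: if the hole's boundary is joined to the outside of the
  domain by a chain of dead edges (edge- OR corner-connected removed cells), the hole is no hole for the observable.
* §2 BOXES, hole two rows above the bottom wall (`h.2 = 2`) and the mirrors (`h.2 + 3 = n`), ANY further defects:
  ★★★★ `lawL_box_deadColumnBelow_not_wound` — the door `holeS | rootS` dead and the cell `holeSS | rootSS` below it dead ⇒ NO wound
  walk of EITHER route (the under half is the parent lineage's one-live-row theorem; the OVER half is new — the predictor had
  it FREE for the `holeS` door) and `…_vertexFunctional_eq_zero`; ★★★★ `lawL_box_holeS_farSWS_h2_not_wound` — `holeS` and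
  `farSWS = (h.1 − 1, 0)` (corner-connected to `holeS`) removed ⇒ no wound walk of either route, `V ≡ 0`; the top mirrors
  `lawL_box_deadColumnAbove_not_wound` / `lawL_box_holeN_farNWN_top_not_wound` with their `V ≡ 0`. These are the six residual
  cells of the scan in the `5 × 5` room; with the dead-cut rule (and the far cell's three-door rule) added, the predictor and the
  generator agree on all 28 896 route-cells: EMPTY ⇔ no witness, FREE ⇔ an unmarked wound witness, MARKED ⇒ no unmarked witness.

Not in print; venture lane «pcv-sawmu», seat b-step0 gen 30 (scan `HOME/code/step0/g30/gen/scan3.py`, `scan4.py`, predictor v3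
`cutcensus3.py`).

References: R. Courant, H. Robbins, *What is Mathematics?* (1941/1958), Ch. V Appendix §2 (the even–odd rule) [CourantRobbins1958];
L. V. Ahlfors, *Complex Analysis* (3rd ed., 1979), Ch. 4 §2.1 (index of a point) [AhlforsCA1979]; A. Glazman, Electron. Commun.
Probab. 20 (2015) no. 86, Lemma 3.1, proof pp. 6–7 [Glazman2015WeightedSAW]; A. Glazman, I. Manolescu, arXiv:1708.00395v3, §1,
§2.1, §4.2, Lemma 2.1 [GlazmanManolescu2019].
-/

noncomputable section

open Set Function Complex

namespace Literature.Probability.RandomPlanarGeometry.SAW.YangBaxter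

open Real

namespace ΩG

variable {D : Set Face} {w : Face}

/-! ## §1 The dead cut -/

/-- ★★★★★ **THE DEAD CUT.** A lattice cut `q 0 = (w.1, w.2), …, q K` from the lower corner of the root edge to a corner beyond the
domain (in one of the four axis directions), every edge of which is DEAD (a face outside `D`): then the excursion polygon of EVERY
class-`B2a` walk at the far cell has winding angle `0` at the root's midpoint — whatever its first side. (A winding excursion exits a
slot through some edge of every such cut, and exit edges are live.)
[cite: CourantRobbins1958, Ch. V Appendix §2 (The Jordan Curve Theorem for Polygons: the even–odd rule)]
[cite: AhlforsCA1979, Ch. 4 §2.1 (index of a point with respect to a closed curve)] [cite: Glazman2015WeightedSAW, Lemma 3.1 (proof, pp. 6–7)] -/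
theorem AJ_root_eq_zero_of_deadCut {q : ℕ → ℤ × ℤ} {c : ℕ → Face} {s : ℕ → Side} {K : ℕ} (hq0 : q 0 = w)
    (hseg : ∀ k, k < K → segment ℝ (toC (cornerPt (q k))) (toC (cornerPt (q (k + 1)))) = sideSeg (c k) (s k))
    (hexit : (∀ f : Face, f ∈ D → f.1 < (q K).1) ∨ (∀ f : Face, f ∈ D → (q K).1 ≤ f.1) ∨
      (∀ f : Face, f ∈ D → (q K).2 ≤ f.2) ∨ (∀ f : Face, f ∈ D → f.2 < (q K).2))
    (hdead : ∀ k, k < K → ((c k).side (s k)).faces.1 ∉ D ∨ ((c k).side (s k)).faces.2 ∉ D)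
    (ω : ΩG D (w.side .W) (farW w)) (hr : RootedFace D (w.side .W) (farW w)) (h : ω.IsB2a) :
    ω.AJ hr h (toC (midPt (w.side .W))) = 0 := by
  by_contra hA
  obtain ⟨k, hk, ⟨j, hj, e⟩, -⟩ :=
    exists_exit_on_cornerChain_of_AJ_ne_zero hr h hq0 hseg (AJ_cornerPt_eq_zero_of_beyond hr h hexit) hA
  have hl := exit_faces_mem hr h hj
  rw [e] at hl
  rcases hdead k hk with hd | hd
  · exact hd hl.1
  · exact hd hl.2

/-- ★★★★★ **THE DEAD CUT, winding form: NO WOUND WALK OF EITHER ROUTE.** Under the hypotheses of `AJ_root_eq_zero_of_deadCut`, every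
class-`B2a` walk at the far cell has its Yang–Baxter winding equal to the excursion winding (either orientation of the witness).
[cite: GlazmanManolescu2019, Lemma 2.1 (statement, "in the form given in [Gl]"), §1 (Fig. 2)]
[cite: Glazman2015WeightedSAW, Lemma 3.1 (proof, pp. 6–7)] [cite: CourantRobbins1958, Ch. V Appendix §2 (the even–odd rule)] -/
theorem WE_eq_excursionWinding_of_deadCut {q : ℕ → ℤ × ℤ} {c : ℕ → Face} {s : ℕ → Side} {K : ℕ} (hq0 : q 0 = w)
    (hseg : ∀ k, k < K → segment ℝ (toC (cornerPt (q k))) (toC (cornerPt (q (k + 1)))) = sideSeg (c k) (s k))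
    (hexit : (∀ f : Face, f ∈ D → f.1 < (q K).1) ∨ (∀ f : Face, f ∈ D → (q K).1 ≤ f.1) ∨
      (∀ f : Face, f ∈ D → (q K).2 ≤ f.2) ∨ (∀ f : Face, f ∈ D → f.2 < (q K).2))
    (hdead : ∀ k, k < K → ((c k).side (s k)).faces.1 ∉ D ∨ ((c k).side (s k)).faces.2 ∉ D)
    (ω : ΩG D (w.side .W) (farW w)) (hr : RootedFace D (w.side .W) (farW w)) (h : ω.IsB2a) (θ : ℝ) :
    ω.WE (fun _ => θ) = excursionWinding θ ω.2.firstSideG (ω.z1 hr h) ω.1 := by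
  by_contra hW
  rcases ω.AJ_ne_zero_or_rev_of_wound hr h θ hW with hA | hA
  · exact hA (AJ_root_eq_zero_of_deadCut hq0 hseg hexit hdead ω hr h)
  · exact hA (AJ_root_eq_zero_of_deadCut hq0 hseg hexit hdead (ω.rev hr) hr (ω.rev_isB2a hr h))

/-- ★★★ **A DEAD COLUMN FROM THE ROOT EDGE DOWN TO THE FLOOR ⇒ NO WOUND WALK.** For some depth `d ≥ 0`: every west side
`vert w.1 y` of the root column with `w.2 − d ≤ y ≤ w.2 − 1` is dead (`(w.1 − 1, y) ∉ D` or `(w.1, y) ∉ D`) and no face of `D` lies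
below row `w.2 − d`. (The straight cut south from the lower corner; `d = 0`: the root plaquette sits on the floor.)
[cite: CourantRobbins1958, Ch. V Appendix §2 (the even–odd rule)] [cite: Glazman2015WeightedSAW, Lemma 3.1 (proof, pp. 6–7)]
[cite: GlazmanManolescu2019, Lemma 2.1 (statement, "in the form given in [Gl]")] -/
theorem WE_eq_excursionWinding_of_deadColumnBelow {d : ℕ}
    (hcol : ∀ y : ℤ, w.2 - d ≤ y → y ≤ w.2 - 1 → ((w.1 - 1, y) : Face) ∉ D ∨ ((w.1, y) : Face) ∉ D)
    (hfloor : ∀ f : Face, f ∈ D → w.2 - d ≤ f.2)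
    (ω : ΩG D (w.side .W) (farW w)) (hr : RootedFace D (w.side .W) (farW w)) (h : ω.IsB2a) (θ : ℝ) :
    ω.WE (fun _ => θ) = excursionWinding θ ω.2.firstSideG (ω.z1 hr h) ω.1 := by
  refine WE_eq_excursionWinding_of_deadCut (q := fun k => (w.1, w.2 - (k : ℤ))) (c := fun k => (w.1, w.2 - 1 - (k : ℤ)))
    (s := fun _ => Side.W) (K := d) (by simp) (fun k hk => ?_) (Or.inr (Or.inr (Or.inl fun f hf => ?_))) (fun k hk => ?_)
    ω hr h θ
  · have := segment_cornerPt_south ((w.1, w.2 - (k : ℤ)) : ℤ × ℤ)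
    simp only [Nat.cast_succ] at this ⊢
    rw [show w.2 - (↑k + 1) = w.2 - ↑k - 1 by ring, show w.2 - 1 - (k : ℤ) = w.2 - ↑k - 1 by ring]
    exact this
  · simpa using hfloor f hf
  · have := hcol (w.2 - 1 - k) (by omega) (by omega)
    simpa [Face.side, MidEdge.faces] using this

/-- ★★★ **THE BENT DEAD CUT BELOW: the door side `vert w.1 (w.2 − 1)` dead, the bottom side of `holeS` dead, the west side of
`holeSS = (w.1 − 1, w.2 − 2)` dead, floor two rows below the hole** (no face of `D` below row `w.2 − 2`) ⇒ no wound walk of either route.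
(The configuration `holeS, farSWS` absent two rows above the bottom wall: `holeS` kills the first two edges, `farSWS` the third.)
[cite: CourantRobbins1958, Ch. V Appendix §2 (the even–odd rule)] [cite: Glazman2015WeightedSAW, Lemma 3.1 (proof, pp. 6–7)]
[cite: GlazmanManolescu2019, Lemma 2.1 (statement, "in the form given in [Gl]")] -/
theorem WE_eq_excursionWinding_of_holeS_farSWS_floor2 (hHS : ((w.1 - 1, w.2 - 1) : Face) ∉ D)
    (hFS : ((w.1 - 2, w.2 - 2) : Face) ∉ D) (hfloor : ∀ f : Face, f ∈ D → w.2 - 2 ≤ f.2)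
    (ω : ΩG D (w.side .W) (farW w)) (hr : RootedFace D (w.side .W) (farW w)) (h : ω.IsB2a) (θ : ℝ) :
    ω.WE (fun _ => θ) = excursionWinding θ ω.2.firstSideG (ω.z1 hr h) ω.1 := by
  refine WE_eq_excursionWinding_of_deadCut
    (q := fun k => if k = 0 then (w.1, w.2) else if k = 1 then (w.1, w.2 - 1) else if k = 2 then (w.1 - 1, w.2 - 1)
      else (w.1 - 1, w.2 - 2))
    (c := fun k => if k = 0 then (w.1, w.2 - 1) else if k = 1 then (w.1 - 1, w.2 - 1) else (w.1 - 1, w.2 - 2))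
    (s := fun k => if k = 1 then Side.S else Side.W) (K := 3)
    (by simp) (fun k hk => ?_) (Or.inr (Or.inr (Or.inl fun f hf => ?_))) (fun k hk => ?_) ω hr h θ
  · interval_cases k
    · simpa using segment_cornerPt_south ((w.1, w.2) : ℤ × ℤ)
    · have := segment_cornerPt_west ((w.1, w.2 - 1) : ℤ × ℤ)
      norm_num at this ⊢
      exact this
    · have := segment_cornerPt_south ((w.1 - 1, w.2 - 1) : ℤ × ℤ)
      norm_num at this ⊢
      rw [show w.2 - 1 - 1 = w.2 - 2 by ring] at this
      exact this
  · have := hfloor f hf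
    simp only [show (3 : ℕ) ≠ 0 from by decide, show (3 : ℕ) ≠ 1 from by decide, show (3 : ℕ) ≠ 2 from by decide, if_false]
    exact this
  · interval_cases k
    · left; simpa [Face.side, MidEdge.faces] using hHS
    · right; simpa [Face.side, MidEdge.faces] using hHS
    · left
      have e : ((w.1 - 2, w.2 - 2) : Face) = (w.1 - 1 - 1, w.2 - 2) := Prod.ext (by simp only; ring) rfl
      simpa [Face.side, MidEdge.faces, e] using hFS

/-- The reflection in the root row on a cell, in coordinates. [cite: GlazmanManolescu2019, §4.2 (lattice symmetries)] -/
private theorem mirrorRowFace_mkDC (w : Face) (x y : ℤ) :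
    Literature.Barriers.CriticalPhenomena.PlaquetteWalk.mirrorRowFace w.2 ((x, y) : Face) = (x, 2 * w.2 - y) := by
  simp [Literature.Barriers.CriticalPhenomena.PlaquetteWalk.mirrorRowFace]

/-- ★★★ **TOP TWIN: A DEAD COLUMN FROM THE ROOT EDGE UP TO THE CEILING ⇒ NO WOUND WALK** (every west side `vert w.1 y` with
`w.2 + 1 ≤ y ≤ w.2 + d` dead, no face above row `w.2 + d`; row mirror of `…_of_deadColumnBelow`).
[cite: GlazmanManolescu2019, §4.2 (lattice symmetries), Lemma 2.1] [cite: CourantRobbins1958, Ch. V Appendix §2 (the even–odd rule)]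
[cite: Glazman2015WeightedSAW, Lemma 3.1 (proof, pp. 6–7)] -/
theorem WE_eq_excursionWinding_of_deadColumnAbove {d : ℕ}
    (hcol : ∀ y : ℤ, w.2 + 1 ≤ y → y ≤ w.2 + d → ((w.1 - 1, y) : Face) ∉ D ∨ ((w.1, y) : Face) ∉ D)
    (hceil : ∀ f : Face, f ∈ D → f.2 ≤ w.2 + d)
    (ω : ΩG D (w.side .W) (farW w)) (hr : RootedFace D (w.side .W) (farW w)) (h : ω.IsB2a) (θ : ℝ) :
    ω.WE (fun _ => θ) = excursionWinding θ ω.2.firstSideG (ω.z1 hr h) ω.1 := by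
  by_contra hW
  have hr' := rootedFace_rowMirrorDom w hr
  have h' := ω.mirrorFar_isB2a hr h
  have hcol' : ∀ y : ℤ, w.2 - d ≤ y → y ≤ w.2 - 1 →
      ((w.1 - 1, y) : Face) ∉ rowMirrorDom w D ∨ ((w.1, y) : Face) ∉ rowMirrorDom w D := by
    intro y hy1 hy2
    rw [mem_rowMirrorDom, mem_rowMirrorDom, mirrorRowFace_mkDC, mirrorRowFace_mkDC]
    exact hcol (2 * w.2 - y) (by omega) (by omega)
  have hfloor' : ∀ f : Face, f ∈ rowMirrorDom w D → w.2 - d ≤ f.2 := by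
    intro f hf
    rw [mem_rowMirrorDom] at hf
    have := hceil _ hf
    obtain ⟨x, y⟩ := f
    rw [mirrorRowFace_mkDC] at this
    simp only at this ⊢
    omega
  exact absurd (WE_eq_excursionWinding_of_deadColumnBelow hcol' hfloor' ω.mirrorFar hr' h' _) (ω.mirrorFar_wound hr h hW)

/-- ★★★ **TOP TWIN OF THE BENT DEAD CUT: `holeN = (w.1 − 1, w.2 + 1)` and `farNWN = (w.1 − 2, w.2 + 2)` absent, ceiling two rows above
the hole** ⇒ no wound walk of either route. [cite: GlazmanManolescu2019, §4.2 (lattice symmetries), Lemma 2.1]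
[cite: CourantRobbins1958, Ch. V Appendix §2 (the even–odd rule)] [cite: Glazman2015WeightedSAW, Lemma 3.1 (proof, pp. 6–7)] -/
theorem WE_eq_excursionWinding_of_holeN_farNWN_ceiling2 (hHN : ((w.1 - 1, w.2 + 1) : Face) ∉ D)
    (hFN : ((w.1 - 2, w.2 + 2) : Face) ∉ D) (hceil : ∀ f : Face, f ∈ D → f.2 ≤ w.2 + 2)
    (ω : ΩG D (w.side .W) (farW w)) (hr : RootedFace D (w.side .W) (farW w)) (h : ω.IsB2a) (θ : ℝ) :
    ω.WE (fun _ => θ) = excursionWinding θ ω.2.firstSideG (ω.z1 hr h) ω.1 := by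
  by_contra hW
  have hr' := rootedFace_rowMirrorDom w hr
  have h' := ω.mirrorFar_isB2a hr h
  have hHS' : ((w.1 - 1, w.2 - 1) : Face) ∉ rowMirrorDom w D := by
    rw [mem_rowMirrorDom, mirrorRowFace_mkDC, show 2 * w.2 - (w.2 - 1) = w.2 + 1 by ring]; exact hHN
  have hFS' : ((w.1 - 2, w.2 - 2) : Face) ∉ rowMirrorDom w D := by
    rw [mem_rowMirrorDom, mirrorRowFace_mkDC, show 2 * w.2 - (w.2 - 2) = w.2 + 2 by ring]; exact hFN
  have hfloor' : ∀ f : Face, f ∈ rowMirrorDom w D → w.2 - 2 ≤ f.2 := by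
    intro f hf
    rw [mem_rowMirrorDom] at hf
    have := hceil _ hf
    obtain ⟨x, y⟩ := f
    rw [mirrorRowFace_mkDC] at this
    simp only at this ⊢
    omega
  exact absurd (WE_eq_excursionWinding_of_holeS_farSWS_floor2 hHS' hFS' hfloor' ω.mirrorFar hr' h' _) (ω.mirrorFar_wound hr h hW)

end ΩG

end Literature.Probability.RandomPlanarGeometry.SAW.YangBaxter

namespace Literature.Barriers.CriticalPhenomena.PlaquetteWalk

open Literature.Probability.RandomPlanarGeometry.SAW.YangBaxter
open Real Complex

/-! ## §1′ The vertex functional behind a dead cut -/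

section DeadCutVF

variable {Dl : List Face} {w : Face}

/-- ★★★ **A DEAD CUT KILLS THE OBSERVABLE.** Far cell present, hole absent, and a lattice cut from the lower corner of the root edge to
beyond the domain through dead edges only ⇒ the Yang–Baxter vertex functional with the printed weights vanishes at every
`θ ∈ [π/3, 2π/3]`. [cite: GlazmanManolescu2019, Lemma 2.1 (statement, "in the form given in [Gl]"), §1 eq. (1)]
[cite: Glazman2015WeightedSAW, Lemma 3.1 (proof, pp. 6–7)] [cite: CourantRobbins1958, Ch. V Appendix §2 (the even–odd rule)] -/
theorem vertexFunctional_printed_eq_zero_of_deadCut {θ : ℝ} (hθ : θ ∈ Set.Icc (π / 3) (2 * π / 3))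
    (hf : farW w ∈ Dl) (hh : holeFaceW w ∉ dom Dl)
    {q : ℕ → ℤ × ℤ} {c : ℕ → Face} {s : ℕ → Side} {K : ℕ} (hq0 : q 0 = w)
    (hseg : ∀ k, k < K → segment ℝ (toC (cornerPt (q k))) (toC (cornerPt (q (k + 1)))) = sideSeg (c k) (s k))
    (hexit : (∀ f : Face, f ∈ dom Dl → f.1 < (q K).1) ∨ (∀ f : Face, f ∈ dom Dl → (q K).1 ≤ f.1) ∨
      (∀ f : Face, f ∈ dom Dl → (q K).2 ≤ f.2) ∨ (∀ f : Face, f ∈ dom Dl → f.2 < (q K).2))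
    (hdead : ∀ k, k < K → ((c k).side (s k)).faces.1 ∉ dom Dl ∨ ((c k).side (s k)).faces.2 ∉ dom Dl) :
    vertexFunctional (printedWeights θ) tFiveEighths (ybCoeff θ) Dl (w.side .W) (farW w) = 0 :=
  vertexFunctional_printed_eq_zero_of_both_unwound hθ hf hh fun hr ω h =>
    ΩG.WE_eq_excursionWinding_of_deadCut hq0 hseg hexit hdead ω hr h θ

end DeadCutVF

/-! ## §2 Boxes: the dead column below / above the hole, and the bent dead cuts, any further defects -/

section Boxes

variable {m n : ℕ} {S : List Face} {h : Face}

/-- ★★★★ **ALL BOXES WITH THE HOLE TWO ROWS ABOVE THE BOTTOM WALL (`h.2 = 2`): the door cell `holeS = (h.1, 1)` or `rootS = (h.1 + 1, 1)`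
removed AND the cell `(h.1, 0)` or `(h.1 + 1, 0)` below it removed ⇒ NO WOUND WALK OF EITHER ROUTE**, whatever else `S ∋ h` removes
(far cell kept). The under half is the lineage's one-live-row theorem; the over half is new.
[cite: GlazmanManolescu2019, Lemma 2.1 (statement, "in the form given in [Gl]"), §2.1]
[cite: Glazman2015WeightedSAW, Lemma 3.1 (proof, pp. 6–7)] [cite: CourantRobbins1958, Ch. V Appendix §2 (the even–odd rule)] -/
theorem lawL_box_deadColumnBelow_not_wound (hW : 1 ≤ h.1) (hE : h.1 ≤ m) (hS2 : h.2 = 2) (hN : 3 ≤ n) (hh : h ∈ S)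
    (hfS : ((h.1 - 1, h.2) : Face) ∉ S) (hc1 : ((h.1, 1) : Face) ∈ S ∨ ((h.1 + 1, 1) : Face) ∈ S)
    (hc0 : ((h.1, 0) : Face) ∈ S ∨ ((h.1 + 1, 0) : Face) ∈ S)
    (ω : ΩG (dom (boxMinus m n S)) (Face.side (h.1 + 1, h.2) .W) (farW (h.1 + 1, h.2))) (hb : ω.IsB2a) (θ : ℝ) :
    ω.WE (fun _ => θ) = excursionWinding θ ω.2.firstSideG
      (ω.z1 (rootedFace_hroot_boxMinus_of_mem (farW_hroot_mem_boxMinus_of_not_mem hW hE (by omega) (by omega) hfS) hh) hb)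
      ω.1 := by
  refine ΩG.WE_eq_excursionWinding_of_deadColumnBelow (d := 2) (fun y hy1 hy2 => ?_) (fun f hf => ?_) ω _ hb θ
  · simp only [Nat.cast_ofNat] at hy1 hy2 ⊢
    have e1 : ((h.1 + 1 - 1, y) : Face) = (h.1, y) := Prod.ext (by simp only; omega) rfl
    rw [e1]
    rcases (show y = 1 ∨ y = 0 by omega) with rfl | rfl
    · rcases hc1 with hc | hc
      · exact Or.inl (not_mem_dom_boxMinus_of_mem hc)
      · exact Or.inr (not_mem_dom_boxMinus_of_mem hc)
    · rcases hc0 with hc | hc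
      · exact Or.inl (not_mem_dom_boxMinus_of_mem hc)
      · exact Or.inr (not_mem_dom_boxMinus_of_mem hc)
  · obtain ⟨hb', -⟩ := mem_dom_boxMinus.1 hf
    simp only [Nat.cast_ofNat] at hb' ⊢
    omega

/-- ★★★ **…hence `V ≡ 0` on `[π/3, 2π/3]`** (dead column below, `h.2 = 2`).
[cite: GlazmanManolescu2019, Lemma 2.1 (statement, "in the form given in [Gl]"), §1 eq. (1), §2.1]
[cite: Glazman2015WeightedSAW, Lemma 3.1 (proof, pp. 6–7)] -/
theorem lawL_box_deadColumnBelow_vertexFunctional_eq_zero (hW : 1 ≤ h.1) (hE : h.1 ≤ m) (hS2 : h.2 = 2) (hN : 3 ≤ n)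
    (hh : h ∈ S) (hfS : ((h.1 - 1, h.2) : Face) ∉ S) (hc1 : ((h.1, 1) : Face) ∈ S ∨ ((h.1 + 1, 1) : Face) ∈ S)
    (hc0 : ((h.1, 0) : Face) ∈ S ∨ ((h.1 + 1, 0) : Face) ∈ S) {θ : ℝ} (hθ : θ ∈ Set.Icc (π / 3) (2 * π / 3)) :
    vertexFunctional (printedWeights θ) tFiveEighths (ybCoeff θ) (boxMinus m n S) (Face.side (h.1 + 1, h.2) .W)
      (farW (h.1 + 1, h.2)) = 0 :=
  vertexFunctional_printed_eq_zero_of_both_unwound hθ (farW_hroot_mem_boxMinus_of_not_mem hW hE (by omega) (by omega) hfS)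
    (by rw [holeFaceW_hroot]; exact not_mem_dom_boxMinus_of_mem hh) fun _ ω hb =>
    lawL_box_deadColumnBelow_not_wound hW hE hS2 hN hh hfS hc1 hc0 ω hb θ

/-- ★★★★ **ALL BOXES WITH `h.2 = 2`: `holeS = (h.1, 1)` AND `(h.1 − 1, 0)` (the cell two below the far cell, corner-connected to `holeS`)
REMOVED ⇒ NO WOUND WALK OF EITHER ROUTE**, whatever else `S ∋ h` removes.
[cite: GlazmanManolescu2019, Lemma 2.1 (statement, "in the form given in [Gl]"), §2.1]
[cite: Glazman2015WeightedSAW, Lemma 3.1 (proof, pp. 6–7)] [cite: CourantRobbins1958, Ch. V Appendix §2 (the even–odd rule)] -/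
theorem lawL_box_holeS_farSWS_h2_not_wound (hW : 1 ≤ h.1) (hE : h.1 ≤ m) (hS2 : h.2 = 2) (hN : 3 ≤ n) (hh : h ∈ S)
    (hfS : ((h.1 - 1, h.2) : Face) ∉ S) (hcH : ((h.1, 1) : Face) ∈ S) (hcF : ((h.1 - 1, 0) : Face) ∈ S)
    (ω : ΩG (dom (boxMinus m n S)) (Face.side (h.1 + 1, h.2) .W) (farW (h.1 + 1, h.2))) (hb : ω.IsB2a) (θ : ℝ) :
    ω.WE (fun _ => θ) = excursionWinding θ ω.2.firstSideG
      (ω.z1 (rootedFace_hroot_boxMinus_of_mem (farW_hroot_mem_boxMinus_of_not_mem hW hE (by omega) (by omega) hfS) hh) hb)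
      ω.1 := by
  refine ΩG.WE_eq_excursionWinding_of_holeS_farSWS_floor2 ?_ ?_ (fun f hf => ?_) ω _ hb θ
  · have e : ((h.1 + 1 - 1, h.2 - 1) : Face) = (h.1, 1) := Prod.ext (by simp only; ring) (by simp only; omega)
    rw [e]; exact not_mem_dom_boxMinus_of_mem hcH
  · have e : ((h.1 + 1 - 2, h.2 - 2) : Face) = (h.1 - 1, 0) := Prod.ext (by simp only; ring) (by simp only; omega)
    rw [e]; exact not_mem_dom_boxMinus_of_mem hcF
  · obtain ⟨hb', -⟩ := mem_dom_boxMinus.1 hf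
    simp only at hb' ⊢
    omega

/-- ★★★ **…hence `V ≡ 0`** (`holeS` + `(h.1 − 1, 0)`, `h.2 = 2`).
[cite: GlazmanManolescu2019, Lemma 2.1 (statement, "in the form given in [Gl]"), §1 eq. (1), §2.1]
[cite: Glazman2015WeightedSAW, Lemma 3.1 (proof, pp. 6–7)] -/
theorem lawL_box_holeS_farSWS_h2_vertexFunctional_eq_zero (hW : 1 ≤ h.1) (hE : h.1 ≤ m) (hS2 : h.2 = 2) (hN : 3 ≤ n)
    (hh : h ∈ S) (hfS : ((h.1 - 1, h.2) : Face) ∉ S) (hcH : ((h.1, 1) : Face) ∈ S) (hcF : ((h.1 - 1, 0) : Face) ∈ S)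
    {θ : ℝ} (hθ : θ ∈ Set.Icc (π / 3) (2 * π / 3)) :
    vertexFunctional (printedWeights θ) tFiveEighths (ybCoeff θ) (boxMinus m n S) (Face.side (h.1 + 1, h.2) .W)
      (farW (h.1 + 1, h.2)) = 0 :=
  vertexFunctional_printed_eq_zero_of_both_unwound hθ (farW_hroot_mem_boxMinus_of_not_mem hW hE (by omega) (by omega) hfS)
    (by rw [holeFaceW_hroot]; exact not_mem_dom_boxMinus_of_mem hh) fun _ ω hb =>
    lawL_box_holeS_farSWS_h2_not_wound hW hE hS2 hN hh hfS hcH hcF ω hb θ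

/-- ★★★★ **TOP TWIN (`h.2 + 3 = n`): the door cell `holeN | rootN` removed AND the cell `holeNN | rootNN` above it removed ⇒ NO WOUND
WALK OF EITHER ROUTE** (the over half is the lineage's `lawL_box_oneLiveRowN2_not_wound_over`; the under half is new).
[cite: GlazmanManolescu2019, Lemma 2.1 (statement, "in the form given in [Gl]"), §2.1, §4.2]
[cite: Glazman2015WeightedSAW, Lemma 3.1 (proof, pp. 6–7)] [cite: CourantRobbins1958, Ch. V Appendix §2 (the even–odd rule)] -/
theorem lawL_box_deadColumnAbove_not_wound (hW : 1 ≤ h.1) (hE : h.1 ≤ m) (hS0 : 0 ≤ h.2) (hN3 : h.2 + 3 = n) (hh : h ∈ S)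
    (hfS : ((h.1 - 1, h.2) : Face) ∉ S)
    (hc1 : ((h.1, h.2 + 1) : Face) ∈ S ∨ ((h.1 + 1, h.2 + 1) : Face) ∈ S)
    (hc2 : ((h.1, h.2 + 2) : Face) ∈ S ∨ ((h.1 + 1, h.2 + 2) : Face) ∈ S)
    (ω : ΩG (dom (boxMinus m n S)) (Face.side (h.1 + 1, h.2) .W) (farW (h.1 + 1, h.2))) (hb : ω.IsB2a) (θ : ℝ) :
    ω.WE (fun _ => θ) = excursionWinding θ ω.2.firstSideG
      (ω.z1 (rootedFace_hroot_boxMinus_of_mem (farW_hroot_mem_boxMinus_of_not_mem hW hE hS0 (by omega) hfS) hh) hb)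
      ω.1 := by
  refine ΩG.WE_eq_excursionWinding_of_deadColumnAbove (d := 2) (fun y hy1 hy2 => ?_) (fun f hf => ?_) ω _ hb θ
  · simp only [Nat.cast_ofNat] at hy1 hy2 ⊢
    have e1 : ((h.1 + 1 - 1, y) : Face) = (h.1, y) := Prod.ext (by simp only; omega) rfl
    rw [e1]
    rcases (show y = h.2 + 1 ∨ y = h.2 + 2 by omega) with rfl | rfl
    · rcases hc1 with hc | hc
      · exact Or.inl (not_mem_dom_boxMinus_of_mem hc)
      · exact Or.inr (not_mem_dom_boxMinus_of_mem hc)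
    · rcases hc2 with hc | hc
      · exact Or.inl (not_mem_dom_boxMinus_of_mem hc)
      · exact Or.inr (not_mem_dom_boxMinus_of_mem hc)
  · obtain ⟨hb', -⟩ := mem_dom_boxMinus.1 hf
    simp only [Nat.cast_ofNat] at hb' ⊢
    omega

/-- ★★★ **…hence `V ≡ 0`** (dead column above, `h.2 + 3 = n`).
[cite: GlazmanManolescu2019, Lemma 2.1 (statement, "in the form given in [Gl]"), §1 eq. (1), §2.1]
[cite: Glazman2015WeightedSAW, Lemma 3.1 (proof, pp. 6–7)] -/
theorem lawL_box_deadColumnAbove_vertexFunctional_eq_zero (hW : 1 ≤ h.1) (hE : h.1 ≤ m) (hS0 : 0 ≤ h.2) (hN3 : h.2 + 3 = n)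
    (hh : h ∈ S) (hfS : ((h.1 - 1, h.2) : Face) ∉ S)
    (hc1 : ((h.1, h.2 + 1) : Face) ∈ S ∨ ((h.1 + 1, h.2 + 1) : Face) ∈ S)
    (hc2 : ((h.1, h.2 + 2) : Face) ∈ S ∨ ((h.1 + 1, h.2 + 2) : Face) ∈ S) {θ : ℝ} (hθ : θ ∈ Set.Icc (π / 3) (2 * π / 3)) :
    vertexFunctional (printedWeights θ) tFiveEighths (ybCoeff θ) (boxMinus m n S) (Face.side (h.1 + 1, h.2) .W)
      (farW (h.1 + 1, h.2)) = 0 :=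
  vertexFunctional_printed_eq_zero_of_both_unwound hθ (farW_hroot_mem_boxMinus_of_not_mem hW hE hS0 (by omega) hfS)
    (by rw [holeFaceW_hroot]; exact not_mem_dom_boxMinus_of_mem hh) fun _ ω hb =>
    lawL_box_deadColumnAbove_not_wound hW hE hS0 hN3 hh hfS hc1 hc2 ω hb θ

/-- ★★★★ **TOP TWIN OF THE BENT CUT (`h.2 + 3 = n`): `holeN = (h.1, h.2 + 1)` AND `(h.1 − 1, h.2 + 2)` REMOVED ⇒ NO WOUND WALK OF
EITHER ROUTE.** [cite: GlazmanManolescu2019, Lemma 2.1 (statement, "in the form given in [Gl]"), §2.1, §4.2]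
[cite: Glazman2015WeightedSAW, Lemma 3.1 (proof, pp. 6–7)] [cite: CourantRobbins1958, Ch. V Appendix §2 (the even–odd rule)] -/
theorem lawL_box_holeN_farNWN_top_not_wound (hW : 1 ≤ h.1) (hE : h.1 ≤ m) (hS0 : 0 ≤ h.2) (hN3 : h.2 + 3 = n) (hh : h ∈ S)
    (hfS : ((h.1 - 1, h.2) : Face) ∉ S) (hcH : ((h.1, h.2 + 1) : Face) ∈ S) (hcF : ((h.1 - 1, h.2 + 2) : Face) ∈ S)
    (ω : ΩG (dom (boxMinus m n S)) (Face.side (h.1 + 1, h.2) .W) (farW (h.1 + 1, h.2))) (hb : ω.IsB2a) (θ : ℝ) :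
    ω.WE (fun _ => θ) = excursionWinding θ ω.2.firstSideG
      (ω.z1 (rootedFace_hroot_boxMinus_of_mem (farW_hroot_mem_boxMinus_of_not_mem hW hE hS0 (by omega) hfS) hh) hb)
      ω.1 := by
  refine ΩG.WE_eq_excursionWinding_of_holeN_farNWN_ceiling2 ?_ ?_ (fun f hf => ?_) ω _ hb θ
  · have e : ((h.1 + 1 - 1, h.2 + 1) : Face) = (h.1, h.2 + 1) := Prod.ext (by simp only; ring) rfl
    rw [e]; exact not_mem_dom_boxMinus_of_mem hcH
  · have e : ((h.1 + 1 - 2, h.2 + 2) : Face) = (h.1 - 1, h.2 + 2) := Prod.ext (by simp only; ring) rfl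
    rw [e]; exact not_mem_dom_boxMinus_of_mem hcF
  · obtain ⟨hb', -⟩ := mem_dom_boxMinus.1 hf
    simp only at hb' ⊢
    omega

/-- ★★★ **…hence `V ≡ 0`** (`holeN` + `(h.1 − 1, h.2 + 2)`, `h.2 + 3 = n`).
[cite: GlazmanManolescu2019, Lemma 2.1 (statement, "in the form given in [Gl]"), §1 eq. (1), §2.1]
[cite: Glazman2015WeightedSAW, Lemma 3.1 (proof, pp. 6–7)] -/
theorem lawL_box_holeN_farNWN_top_vertexFunctional_eq_zero (hW : 1 ≤ h.1) (hE : h.1 ≤ m) (hS0 : 0 ≤ h.2) (hN3 : h.2 + 3 = n)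
    (hh : h ∈ S) (hfS : ((h.1 - 1, h.2) : Face) ∉ S) (hcH : ((h.1, h.2 + 1) : Face) ∈ S) (hcF : ((h.1 - 1, h.2 + 2) : Face) ∈ S)
    {θ : ℝ} (hθ : θ ∈ Set.Icc (π / 3) (2 * π / 3)) :
    vertexFunctional (printedWeights θ) tFiveEighths (ybCoeff θ) (boxMinus m n S) (Face.side (h.1 + 1, h.2) .W)
      (farW (h.1 + 1, h.2)) = 0 :=
  vertexFunctional_printed_eq_zero_of_both_unwound hθ (farW_hroot_mem_boxMinus_of_not_mem hW hE hS0 (by omega) hfS)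
    (by rw [holeFaceW_hroot]; exact not_mem_dom_boxMinus_of_mem hh) fun _ ω hb =>
    lawL_box_holeN_farNWN_top_not_wound hW hE hS0 hN3 hh hfS hcH hcF ω hb θ

end Boxes

end Literature.Barriers.CriticalPhenomena.PlaquetteWalk
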